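import Summits.KontsevichZagierPeriods.Zeta5Search.Zudilin2003ExactRates
import Summits.KontsevichZagierPeriods.Zeta5Search.TailSqueeze
import HarnessLib

/-!
# ζ(5) search — Catalan arm: EXACT decay of Zudilin's 2003 forms; `theorem1 → rates` (cell `pub-zeta5`, TYPER)

HONEST FRAMING: systematic search; no irrationality claim unless certified.

Sequel of `Zudilin2003ExactRates.lean` (growth `uₙ^{1/n} → ((1+√5)/2)⁵` PROVED) for Zudilin's
second-order recursion (2) for Catalan's constant (`Literature.…Zudilin2003.{u, v, form, theorem1,
rates}`). The recursion has `tₙ < 0`, so the Casoratian `Wₙ = uₙv_{n+1} - u_{n+1}vₙ = (∏ tᵢ)·13/8`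
ALTERNATES and the same-sign telescoping of `RecurrenceCertificateDecay.lean` does not apply; the
sign-free `TailSqueeze` does, with the contraction constant `θ = 1/50`
(`|d_{n+1}/dₙ| = |tₙ| uₙ/u_{n+2} ≤ 1/7.5²` for `n ≥ 2`, and `0.0137`, `0.0089` at `n = 0, 1`). PROVED:

* `tendsto_log_abs_casW_div` — `log|Wₙ|/n → 0` (`W_{n+1}/Wₙ = tₙ → -1`);
* `tendsto_log_abs_step_div` — `log|v_{n+1}/u_{n+1} - vₙ/uₙ|/n → -2 log λ∞`, `λ∞ = ((1+√5)/2)⁵`;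
* for THE LIMIT `L` of `vₙ/uₙ` (it exists: `Zudilin2003Casoratian.exists_limit`), unconditionally:
  `form_ne_zero_of_tendsto` — `uₙL - vₙ ≠ 0` for EVERY `n`; `tendsto_log_abs_form_div_of_tendsto` —
  `log|uₙL - vₙ|/n → -log λ∞`; `tendsto_root_abs_form_of_tendsto` — `|uₙL - vₙ|^{1/n} → ((√5-1)/2)⁵`;
* `rates_of_theorem1` — **`Zudilin2003.theorem1 → Zudilin2003.rates`**: granted only the
  identification `vₙ/uₙ → G` (the analytic content of Theorem 1, a cited fact), ALL THREE conjuncts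
  of the cited `rates` (growth, non-vanishing of `uₙG - vₙ` for all `n`, decay `((√5-1)/2)⁵`) are
  theorems of the tree. (The growth conjunct is unconditional: `tendsto_root_u`.)
-/

noncomputable section

open Filter Topology Finset
open Literature.NumberTheory.Irrationality.Zudilin2003
open Literature.NumberTheory.Transcendental
open Literature.Analysis.Asymptotics.PoincareRecurrence

namespace Summit.KontsevichZagierPeriods.Zeta5Search

namespace Zudilin2003Growth

/-! ### The Casoratian and the steps of the approximants -/

/-- The Casoratian `Wₙ = uₙv_{n+1} - u_{n+1}vₙ` (real). -/
def casW (n : ℕ) : ℝ := uR n * vR (n + 1) - uR (n + 1) * vR n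

/-- The approximants `rₙ = vₙ/uₙ`. -/
def approx (n : ℕ) : ℝ := vR n / uR n

/-- Abel, one step: `W_{n+1} = tₙ Wₙ`. -/
theorem casW_succ (n : ℕ) : casW (n + 1) = tC n * casW n := by
  unfold casW
  rw [show n + 1 + 1 = n + 2 by ring]
  exact casoratian_succ uR vR sC tC n (uR_rec n) (vR_rec n)

/-- `Wₙ ≠ 0`. -/
theorem casW_ne_zero (n : ℕ) : casW n ≠ 0 := casoratian_ne_zero n

/-- `r_{n+1} - rₙ = Wₙ/(uₙu_{n+1})`. -/
theorem step_eq (n : ℕ) : approx (n + 1) - approx n = casW n / (uR n * uR (n + 1)) := by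
  have h0 := (uR_pos n).ne'
  have h1 := (uR_pos (n + 1)).ne'
  unfold approx casW
  field_simp

/-- The steps never vanish. -/
theorem step_ne_zero (n : ℕ) : approx (n + 1) ≠ approx n := by
  intro h
  have h2 := step_eq n
  rw [h, sub_self] at h2
  exact div_ne_zero (casW_ne_zero n) (mul_pos (uR_pos n) (uR_pos (n + 1))).ne' h2.symm

/-- `r_{n+2} - r_{n+1} = (r_{n+1} - rₙ) · tₙuₙ/u_{n+2}`. -/
theorem step_succ (n : ℕ) :
    approx (n + 2) - approx (n + 1) = (approx (n + 1) - approx n) * (tC n * uR n / uR (n + 2)) := by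
  have h0 := (uR_pos n).ne'
  have h1 := (uR_pos (n + 1)).ne'
  have h2 := (uR_pos (n + 2)).ne'
  rw [show n + 2 = n + 1 + 1 by ring, step_eq (n + 1), step_eq n, casW_succ n,
    show n + 1 + 1 = n + 2 by ring]
  field_simp

/-- `uR 0 = 1`, `uR 1 = 7/4`, `uR 2 = 649/64`, `uR 3 = 19471/256`. -/
theorem uR_values : uR 0 = 1 ∧ uR 1 = 7 / 4 ∧ uR 2 = 649 / 64 ∧ uR 3 = 19471 / 256 := by
  unfold uR
  refine ⟨?_, ?_, ?_, ?_⟩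
  · unfold u; rw [sol_zero]; norm_num
  · unfold u; rw [sol_one]; norm_num
  · rw [u_two]; norm_num
  · rw [u_three]; norm_num

/-- **The contraction factor**: `|tₙ| uₙ/u_{n+2} ≤ 1/50` for every `n`
(`n ≥ 2`: `|tₙ| ≤ 1`, `u_{n+2} ≥ (15/2)² uₙ`; `n = 0, 1`: `0.0137…`, `0.0088…` by evaluation). -/
theorem contraction_le (n : ℕ) : |tC n| * uR n / uR (n + 2) ≤ 1 / 50 := by
  have hu2 := uR_pos (n + 2)
  rw [div_le_iff₀ hu2]
  rcases Nat.lt_or_ge n 2 with hlt | hge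
  · interval_cases n
    · obtain ⟨h0, -, h2, -⟩ := uR_values
      have ht : |tC 0| = 5 / 36 := by
        unfold tC TC LC; simp only [p]; norm_num
      rw [ht, h0, show (0 + 2 : ℕ) = 2 from rfl, h2]; norm_num
    · obtain ⟨-, h1, -, h3⟩ := uR_values
      have ht : |tC 1| = 22608 / 58500 := by
        unfold tC TC LC; simp only [p]; norm_num
      rw [ht, h1, show (1 + 2 : ℕ) = 3 from rfl, h3]; norm_num
  · have ht := abs_tC_le_one n
    have hu0 := uR_pos n
    have hg1 := (ratio_bounds n hge).2.1
    have hg2 := (ratio_bounds (n + 1) (by omega)).2.1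
    rw [show n + 1 + 1 = n + 2 by ring] at hg2
    have hu2' : (15 / 2 : ℝ) ^ 2 * uR n ≤ uR (n + 2) := by nlinarith
    have : |tC n| * uR n ≤ uR n := by nlinarith [abs_nonneg (tC n)]
    nlinarith

/-- **Geometric shrinking of the steps**: `|r_{k+2} - r_{k+1}| ≤ (1/50)|r_{k+1} - r_k|` for all `k`. -/
theorem abs_step_succ_le (k : ℕ) (_hk : 0 ≤ k) :
    |approx (k + 2) - approx (k + 1)| ≤ 1 / 50 * |approx (k + 1) - approx k| := by
  rw [step_succ k, abs_mul, mul_comm]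
  refine mul_le_mul_of_nonneg_right ?_ (abs_nonneg _)
  rw [abs_div, abs_mul, abs_of_pos (uR_pos k), abs_of_pos (uR_pos (k + 2))]
  exact contraction_le k

/-! ### Exact rates of the Casoratian and of the steps -/

/-- `log|Wₙ|/n → 0` (`W_{n+1}/Wₙ = tₙ → -1`, Elaydi's Lemma 7.14). -/
theorem tendsto_log_abs_casW_div : Tendsto (fun n : ℕ => Real.log |casW n| / n) atTop (𝓝 0) := by
  have h := tendsto_log_abs_div_of_tendsto_ratio casW 0 (fun n _ => casW_ne_zero n)
    (show (-1 : ℝ) ≠ 0 by norm_num) (tendsto_tC.congr fun n => by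
      rw [casW_succ, mul_div_cancel_right₀ _ (casW_ne_zero n)])
  simpa using h

/-- `log u_{n+1} / n → log λ∞`. -/
theorem tendsto_log_u_succ_div :
    Tendsto (fun n : ℕ => Real.log (uR (n + 1)) / n) atTop
      (𝓝 (Real.log (((1 + Real.sqrt 5) / 2) ^ 5))) := by
  have hl0 : (0 : ℝ) < ((1 + Real.sqrt 5) / 2) ^ 5 := by
    have := two_lt_sqrt_five; positivity
  have h1 : Tendsto (fun n : ℕ => Real.log (uR (n + 1) / uR n)) atTop
      (𝓝 (Real.log (((1 + Real.sqrt 5) / 2) ^ 5))) := tendsto_ratio_uR.log hl0.ne'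
  have h2 : Tendsto (fun n : ℕ => Real.log (uR (n + 1) / uR n) / n) atTop (𝓝 0) :=
    h1.div_atTop tendsto_natCast_atTop_atTop
  have h3 := tendsto_log_u_div.add h2
  rw [add_zero] at h3
  refine h3.congr fun n => ?_
  have hu0 := uR_pos n
  have hu1 := uR_pos (n + 1)
  show Real.log (u n : ℝ) / n + Real.log (uR (n + 1) / uR n) / n = Real.log (uR (n + 1)) / n
  rw [← add_div, Real.log_div hu1.ne' hu0.ne']
  unfold uR
  ring

/-- **Exact rate of the steps**: `log|r_{n+1} - rₙ|/n → -2 log λ∞`. -/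
theorem tendsto_log_abs_step_div :
    Tendsto (fun n : ℕ => Real.log |approx (n + 1) - approx n| / n) atTop
      (𝓝 (-2 * Real.log (((1 + Real.sqrt 5) / 2) ^ 5))) := by
  have h := (tendsto_log_abs_casW_div.sub tendsto_log_u_div).sub tendsto_log_u_succ_div
  have e : (0 : ℝ) - Real.log (((1 + Real.sqrt 5) / 2) ^ 5) - Real.log (((1 + Real.sqrt 5) / 2) ^ 5) =
      -2 * Real.log (((1 + Real.sqrt 5) / 2) ^ 5) := by ring
  rw [e] at h
  refine h.congr fun n => ?_
  have hu0 := uR_pos n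
  have hu1 := uR_pos (n + 1)
  have hW := abs_pos.2 (casW_ne_zero n)
  show Real.log |casW n| / n - Real.log (u n : ℝ) / n - Real.log (uR (n + 1)) / n =
    Real.log |approx (n + 1) - approx n| / n
  rw [step_eq n, abs_div, abs_mul, abs_of_pos hu0, abs_of_pos hu1,
    Real.log_div hW.ne' (mul_pos hu0 hu1).ne', Real.log_mul hu0.ne' hu1.ne']
  unfold uR
  ring

/-! ### The limit `L` of `vₙ/uₙ`: non-vanishing and exact decay of `uₙL - vₙ` -/

/-- `((√5-1)/2)⁵ = (((1+√5)/2)⁵)⁻¹`. -/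
theorem golden_conj_fifth : ((Real.sqrt 5 - 1) / 2) ^ 5 = ((((1 + Real.sqrt 5) / 2) ^ 5))⁻¹ := by
  have hs : Real.sqrt 5 ^ 2 = 5 := Real.sq_sqrt (by norm_num)
  rw [← inv_pow]
  congr 1
  refine eq_inv_of_mul_eq_one_left ?_
  nlinarith

variable {L : ℝ}

/-- **Non-vanishing**: if `vₙ/uₙ → L` then `uₙL - vₙ ≠ 0` for EVERY `n`. -/
theorem form_ne_zero_of_tendsto (hL : Tendsto (fun n : ℕ => vR n / uR n) atTop (𝓝 L)) (n : ℕ) :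
    uR n * L - vR n ≠ 0 := by
  have h := TailSqueeze.lim_sub_ne_zero approx 0 (θ := 1 / 50) (by norm_num) (by norm_num) hL
    abs_step_succ_le n (Nat.zero_le n) (step_ne_zero n)
  have hu := (uR_pos n).ne'
  unfold approx at h
  intro h0
  apply h
  field_simp
  linarith

/-- **Exact approximation rate**: if `vₙ/uₙ → L` then `log|L - vₙ/uₙ|/n → -2 log λ∞`. -/
theorem tendsto_log_abs_sub_div_of_tendsto (hL : Tendsto (fun n : ℕ => vR n / uR n) atTop (𝓝 L)) :
    Tendsto (fun n : ℕ => Real.log |L - vR n / uR n| / n) atTop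
      (𝓝 (-2 * Real.log (((1 + Real.sqrt 5) / 2) ^ 5))) :=
  TailSqueeze.tendsto_log_abs_lim_sub_div approx 0 (θ := 1 / 50) (by norm_num) (by norm_num) hL
    abs_step_succ_le (fun k _ => step_ne_zero k) tendsto_log_abs_step_div

/-- **Exact decay of the forms**: if `vₙ/uₙ → L` then `log|uₙL - vₙ|/n → -log λ∞ = -2.40605912…`. -/
theorem tendsto_log_abs_form_div_of_tendsto (hL : Tendsto (fun n : ℕ => vR n / uR n) atTop (𝓝 L)) :
    Tendsto (fun n : ℕ => Real.log |uR n * L - vR n| / n) atTop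
      (𝓝 (-Real.log (((1 + Real.sqrt 5) / 2) ^ 5))) := by
  have h := tendsto_log_u_div.add (tendsto_log_abs_sub_div_of_tendsto hL)
  have e : Real.log (((1 + Real.sqrt 5) / 2) ^ 5) + -2 * Real.log (((1 + Real.sqrt 5) / 2) ^ 5) =
      -Real.log (((1 + Real.sqrt 5) / 2) ^ 5) := by ring
  rw [e] at h
  refine h.congr fun n => ?_
  have hu := uR_pos n
  have hid : uR n * L - vR n = uR n * (L - vR n / uR n) := by field_simp
  show Real.log (u n : ℝ) / n + Real.log |L - vR n / uR n| / n = Real.log |uR n * L - vR n| / n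
  by_cases h0 : L - vR n / uR n = 0
  · exfalso; exact form_ne_zero_of_tendsto hL n (by rw [hid, h0, mul_zero])
  · rw [hid, abs_mul, abs_of_pos hu, Real.log_mul hu.ne' (abs_ne_zero.2 h0), add_div]
    rfl

/-- **`|uₙL - vₙ|^{1/n} → ((√5-1)/2)⁵`** if `vₙ/uₙ → L`. -/
theorem tendsto_root_abs_form_of_tendsto (hL : Tendsto (fun n : ℕ => vR n / uR n) atTop (𝓝 L)) :
    Tendsto (fun n : ℕ => |uR n * L - vR n| ^ (1 / (n : ℝ))) atTop
      (𝓝 (((Real.sqrt 5 - 1) / 2) ^ 5)) := by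
  have hl0 : (0 : ℝ) < ((1 + Real.sqrt 5) / 2) ^ 5 := by
    have := two_lt_sqrt_five; positivity
  have h1 := (Real.continuous_exp.tendsto _).comp (tendsto_log_abs_form_div_of_tendsto hL)
  rw [Real.exp_neg, Real.exp_log hl0, ← golden_conj_fifth] at h1
  refine h1.congr' ?_
  filter_upwards [eventually_ge_atTop 1] with n hn
  have hf := abs_pos.2 (form_ne_zero_of_tendsto hL n)
  simp only [Function.comp]
  rw [Real.rpow_def_of_pos hf]
  congr 1
  ring

/-! ### `theorem1 → rates` -/

/-- **The rates follow from the identification of the limit.** If `vₙ/uₙ → G`, all three conjuncts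
of the cited `Zudilin2003.rates` hold. -/
theorem rates_of_tendsto (hG : Tendsto (fun n : ℕ => vR n / uR n) atTop (𝓝 catalanConstant)) :
    rates := by
  refine ⟨tendsto_root_u, fun n => ?_, ?_⟩
  · have h := form_ne_zero_of_tendsto hG n
    unfold form; unfold uR vR at h; exact h
  · have h := tendsto_root_abs_form_of_tendsto hG
    refine h.congr fun n => ?_
    unfold form uR vR
    rfl

/-- **`Zudilin2003.theorem1 → Zudilin2003.rates`**: the cited rates are a COROLLARY of the cited
Theorem 1 (only its last clause `vₙ/uₙ → G` is used) — growth by Poincaré, non-vanishing and decay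
by the tail squeeze. -/
theorem rates_of_theorem1 (h : theorem1) : rates := by
  refine rates_of_tendsto (h.2.congr fun n => ?_)
  unfold vR uR
  push_cast
  rfl

end Zudilin2003Growth

end Summit.KontsevichZagierPeriods.Zeta5Search
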